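import Literature.Geometry.Lorentzian.KerrDataSchwarzschildExtrinsic
import Literature.Geometry.Lorentzian.LandauLifshitzPseudotensor

/-!
# Route EIHFluxBalance — crux `InertialRecession`: Cartesian calculus of `x_i x_j / r^n` on `E3`

Helper file (`--supports stmt-FinalStateConjecture-10166`) for the crux
`Summit.FinalStateConjecture.FinalStateConjecture.Theses.EIHFluxBalance.InertialRecession`, part of
the exact Landau–Lifshitz charge of a Schwarzschild hole at rest (see
`…SchwarzschildLLComponents`). The momentum densities `h^{μ0j}` of the Schwarzschild
Kerr–Schild metric are coordinate derivatives of the rational functions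
`−δ_{lj}(1 + 2M/r) + 2M x_l x_j/r³` and `2M(x_k δ_{lj} − x_l δ_{kj})/r²` of `x̄ ∈ E3 ∖ {0}`; their
divergences are derivatives of `x_j/r³` and `x_j x_k/r⁴`. This file records that calculus:
* `hasFDerivAt_coord_div_norm_pow`, `hasFDerivAt_coord_mul_coord_div_norm_pow` — the derivatives
  of `x_k / rⁿ` and `x_i x_k / rⁿ` off the origin (Leibniz rule with the tree's
  `Kerr.hasFDerivAt_inv_norm_pow`), and the coordinate facts `proj_single`, `inner_single_right_real`;
* the four **contracted derivatives** (`e_l` the coordinate directions, sums over `l`):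
  `Σ_l ∂_l [−δ_{lj}(1 + 2M/r) + 2M x_l x_j / r³] = 4M x_j / r³` (`sum_fderiv_momentumPotential`),
  `Σ_l ∂_l [2M (x_k δ_{lj} − x_l δ_{kj}) / r²] = −4M x_j x_k / r⁴` (`sum_fderiv_fluxPotential`),
  `Σ_l ∂_l [x_l / r³] = 0` (`sum_fderiv_coulomb`), `Σ_l ∂_l [x_j x_l / r⁴] = 0`
  (`sum_fderiv_dipoleQuartic`) — the last two say that the Schwarzschild momentum densities are
  divergence free off the centre;
* `fderiv_apply_eq_zero_of_forall_add_smul` — a function constant along a line has vanishing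
  derivative along it (whether or not it is differentiable), and `partialDeriv_comp_spatial` —
  coordinate partials on `E4` of a function of the spatial part.
Elementary multivariable calculus. [folklore]
-/

set_option linter.dupNamespace false

noncomputable section

open Set Filter
open scoped Topology RealInnerProductSpace

namespace Summit.FinalStateConjecture.FinalStateConjecture.Theorems

namespace LLSchwarzschild

open Literature.Geometry.Lorentzian Literature.Geometry.Lorentzian.LandauLifshitz
open Literature.Geometry.Lorentzian.Kerr

/-! ### Coordinate derivatives on `E3` -/

/-- `⟪y, e_l⟫ = y_l` on `E3`. [folklore] -/
theorem inner_single_right_real (y : E3) (l : Fin 3) :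
    ⟪y, (EuclideanSpace.single l (1 : ℝ) : E3)⟫ = y l := by
  rw [EuclideanSpace.inner_single_right]
  simp

/-- The coordinate functions are their own derivatives. [folklore] -/
theorem hasFDerivAt_coord (i : Fin 3) (y : E3) :
    HasFDerivAt (fun z : E3 ↦ (z i : ℝ)) (EuclideanSpace.proj (𝕜 := ℝ) i : E3 →L[ℝ] ℝ) y :=
  (EuclideanSpace.proj (𝕜 := ℝ) i : E3 →L[ℝ] ℝ).hasFDerivAt

/-- `∂_{e_l} x_i = δ_{il}`. [folklore] -/
theorem proj_single (i l : Fin 3) :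
    (EuclideanSpace.proj (𝕜 := ℝ) i : E3 →L[ℝ] ℝ) (EuclideanSpace.single l (1 : ℝ)) =
      if i = l then 1 else 0 := by
  simp [PiLp.single_apply]

/-- `y₀² + y₁² + y₂² = |y|²` on `E3`. [folklore] -/
theorem sum_sq_eq_norm_sq_E3 (y : E3) : y 0 ^ 2 + y 1 ^ 2 + y 2 ^ 2 = ‖y‖ ^ 2 := by
  rw [EuclideanSpace.real_norm_sq_eq, Fin.sum_univ_three]

/-- `Σ_l y_l y_l = |y|²` on `E3`. [folklore] -/
theorem sum_mul_self_eq_norm_sq_E3 (y : E3) : ∑ l : Fin 3, y l * y l = ‖y‖ ^ 2 := by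
  rw [← sum_sq_eq_norm_sq_E3, Fin.sum_univ_three]
  ring

/-! ### Derivatives of `x_k / rⁿ` and `x_i x_k / rⁿ` -/

/-- **`D[x_k / rⁿ](y) = r⁻ⁿ dx_k − n x_k r^{−n−2} ⟪y, ·⟫`** off the origin. [folklore] -/
theorem hasFDerivAt_coord_div_norm_pow {y : E3} (hy : y ≠ 0) (k : Fin 3) (n : ℕ) :
    HasFDerivAt (fun z : E3 ↦ z k / ‖z‖ ^ n)
      (y k • ((-(n : ℝ) / ‖y‖ ^ (n + 2)) • E3.covec y) +
        (‖y‖ ^ n)⁻¹ • (EuclideanSpace.proj (𝕜 := ℝ) k : E3 →L[ℝ] ℝ)) y := by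
  have h := (hasFDerivAt_coord k y).mul (hasFDerivAt_inv_norm_pow hy n)
  simp_rw [div_eq_mul_inv]
  exact h

/-- **`D[x_i x_k / rⁿ](y) = r⁻ⁿ (x_i dx_k + x_k dx_i) − n x_i x_k r^{−n−2} ⟪y, ·⟫`** off the origin.
[folklore] -/
theorem hasFDerivAt_coord_mul_coord_div_norm_pow {y : E3} (hy : y ≠ 0) (i k : Fin 3) (n : ℕ) :
    HasFDerivAt (fun z : E3 ↦ z i * z k / ‖z‖ ^ n)
      ((y i * y k) • ((-(n : ℝ) / ‖y‖ ^ (n + 2)) • E3.covec y) +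
        (‖y‖ ^ n)⁻¹ • (y i • (EuclideanSpace.proj (𝕜 := ℝ) k : E3 →L[ℝ] ℝ) +
          y k • (EuclideanSpace.proj (𝕜 := ℝ) i : E3 →L[ℝ] ℝ))) y := by
  have h := ((hasFDerivAt_coord i y).mul (hasFDerivAt_coord k y)).mul (hasFDerivAt_inv_norm_pow hy n)
  simp_rw [div_eq_mul_inv]
  exact h

/-! ### The contracted derivatives -/

/-- **`Σ_l ∂_l [x_l / rⁿ] = (3 − n) / rⁿ`** off the origin (`div (x̄/rⁿ)`; zero for the Coulomb
field `n = 3`). [folklore] -/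
theorem sum_fderiv_coord_div_norm_pow {y : E3} (hy : y ≠ 0) (n : ℕ) :
    ∑ l : Fin 3, fderiv ℝ (fun z : E3 ↦ z l / ‖z‖ ^ n) y (EuclideanSpace.single l 1) =
      (3 - n) / ‖y‖ ^ n := by
  have hr : ‖y‖ ≠ 0 := norm_ne_zero_iff.2 hy
  have hs := sum_sq_eq_norm_sq_E3 y
  simp_rw [fun l ↦ (hasFDerivAt_coord_div_norm_pow hy l n).fderiv]
  simp only [FunLike.coe_add, FunLike.coe_smul, Pi.add_apply,
    Pi.smul_apply, E3.covec_apply, inner_single_right_real, proj_single, smul_eq_mul, if_true,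
    Fin.sum_univ_three]
  field_simp
  linear_combination (-(n : ℝ) * ‖y‖ ^ n) * hs

/-- **`Σ_l ∂_l [x_l x_i / rⁿ] = (4 − n) x_i / rⁿ`** off the origin (zero for `n = 4`).
[folklore] -/
theorem sum_fderiv_coord_mul_coord_div_norm_pow {y : E3} (hy : y ≠ 0) (i : Fin 3) (n : ℕ) :
    ∑ l : Fin 3, fderiv ℝ (fun z : E3 ↦ z l * z i / ‖z‖ ^ n) y (EuclideanSpace.single l 1) =
      (4 - n) * y i / ‖y‖ ^ n := by
  have hr : ‖y‖ ≠ 0 := norm_ne_zero_iff.2 hy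
  have hs := sum_sq_eq_norm_sq_E3 y
  simp_rw [fun l ↦ (hasFDerivAt_coord_mul_coord_div_norm_pow hy l i n).fderiv]
  simp only [FunLike.coe_add, FunLike.coe_smul, Pi.add_apply,
    Pi.smul_apply, E3.covec_apply, inner_single_right_real, proj_single, smul_eq_mul, if_true,
    Fin.sum_univ_three]
  fin_cases i <;> simp <;> field_simp <;> linear_combination (-(n : ℝ) * y _ * ‖y‖ ^ n) * hs

/-! ### The four contracted derivatives of the Schwarzschild momentum potentials -/

/-- **`Σ_l ∂_l [−δ_{lj}(1 + 2M/r) + 2M x_l x_j / r³] = 4M x_j / r³`** off the origin — the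
contraction producing `16π h^{00j}` of the Schwarzschild Kerr–Schild metric.
[cite: LandauLifshitz1975, §96 (96.2)] -/
theorem sum_fderiv_momentumPotential (M : ℝ) {y : E3} (hy : y ≠ 0) (j : Fin 3) :
    ∑ l : Fin 3, fderiv ℝ (fun z : E3 ↦ -(if l = j then (1 : ℝ) else 0) * (1 + 2 * M / ‖z‖) +
        2 * M * (z l * z j / ‖z‖ ^ 3)) y (EuclideanSpace.single l 1) = 4 * M * y j / ‖y‖ ^ 3 := by
  have hr : ‖y‖ ≠ 0 := norm_ne_zero_iff.2 hy
  -- the first summand and its derivative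
  have h1 : HasFDerivAt (fun z : E3 ↦ 1 + 2 * M / ‖z‖)
      ((-(2 * M * (1 : ℕ)) / ‖y‖ ^ (1 + 2)) • E3.covec y) y := by
    have h := (hasFDerivAt_const_div_norm_pow (2 * M) hy 1).const_add 1
    simp_rw [pow_one] at h
    exact h
  have hsplit : ∀ l : Fin 3, fderiv ℝ (fun z : E3 ↦ -(if l = j then (1 : ℝ) else 0) * (1 + 2 * M / ‖z‖) +
      2 * M * (z l * z j / ‖z‖ ^ 3)) y (EuclideanSpace.single l 1) =
      -(if l = j then (1 : ℝ) else 0) * (-(2 * M) / ‖y‖ ^ 3 * y l) +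
        2 * M * fderiv ℝ (fun z : E3 ↦ z l * z j / ‖z‖ ^ 3) y (EuclideanSpace.single l 1) := by
    intro l
    have h2 := hasFDerivAt_coord_mul_coord_div_norm_pow hy l j 3
    rw [((h1.const_mul _).fun_add (h2.const_mul (2 * M))).fderiv, h2.fderiv]
    simp only [FunLike.coe_add, FunLike.coe_smul, Pi.add_apply,
      Pi.smul_apply, E3.covec_apply, inner_single_right_real, smul_eq_mul]
    push_cast
    ring
  simp_rw [hsplit]
  rw [Finset.sum_add_distrib, ← Finset.mul_sum, sum_fderiv_coord_mul_coord_div_norm_pow hy j 3]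
  simp only [neg_mul, ite_mul, one_mul, zero_mul, Finset.sum_neg_distrib, Finset.sum_ite_eq',
    Finset.mem_univ, if_true]
  field_simp
  ring

/-- **`Σ_l ∂_l [2M (x_k δ_{lj} − x_l δ_{kj}) / r²] = −4M x_j x_k / r⁴`** off the origin — the
contraction producing `16π h^{k0j}` of the Schwarzschild Kerr–Schild metric.
[cite: LandauLifshitz1975, §96 (96.2)] -/
theorem sum_fderiv_fluxPotential (M : ℝ) {y : E3} (hy : y ≠ 0) (k j : Fin 3) :
    ∑ l : Fin 3, fderiv ℝ (fun z : E3 ↦ 2 * M * ((if l = j then (1 : ℝ) else 0) * (z k / ‖z‖ ^ 2) -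
        (if k = j then (1 : ℝ) else 0) * (z l / ‖z‖ ^ 2))) y (EuclideanSpace.single l 1) =
      -(4 * M * y j * y k / ‖y‖ ^ 4) := by
  have hr : ‖y‖ ≠ 0 := norm_ne_zero_iff.2 hy
  have hsplit : ∀ l : Fin 3, fderiv ℝ (fun z : E3 ↦ 2 * M * ((if l = j then (1 : ℝ) else 0) *
      (z k / ‖z‖ ^ 2) - (if k = j then (1 : ℝ) else 0) * (z l / ‖z‖ ^ 2))) y
      (EuclideanSpace.single l 1) =
      2 * M * ((if l = j then (1 : ℝ) else 0) *
        ((if k = l then (1 : ℝ) else 0) / ‖y‖ ^ 2 - 2 * y k * y l / ‖y‖ ^ 4)) -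
        2 * M * (if k = j then (1 : ℝ) else 0) *
          fderiv ℝ (fun z : E3 ↦ z l / ‖z‖ ^ 2) y (EuclideanSpace.single l 1) := by
    intro l
    have hk := hasFDerivAt_coord_div_norm_pow hy k 2
    have hl := hasFDerivAt_coord_div_norm_pow hy l 2
    rw [(((hk.const_mul _).fun_sub (hl.const_mul _)).const_mul (2 * M)).fderiv, hl.fderiv]
    simp only [FunLike.coe_add, FunLike.coe_smul,
      FunLike.coe_sub, Pi.add_apply, Pi.sub_apply, Pi.smul_apply, E3.covec_apply,
      inner_single_right_real, proj_single, smul_eq_mul]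
    push_cast
    field_simp
    ring
  simp_rw [hsplit]
  rw [Finset.sum_sub_distrib, ← Finset.mul_sum, ← Finset.mul_sum, sum_fderiv_coord_div_norm_pow hy 2]
  simp only [ite_mul, one_mul, zero_mul, Finset.sum_ite_eq', Finset.mem_univ, if_true, mul_ite,
    mul_one, mul_zero]
  by_cases hkj : k = j
  · subst hkj
    simp only [if_true]
    field_simp
    ring
  · simp only [hkj, if_false]
    field_simp
    ring

/-- **`Σ_l ∂_l [M x_l / (4π r³)] = 0`** off the origin: the Schwarzschild energy density
`h^{00·}` is divergence free (the Coulomb field). [cite: LandauLifshitz1975, §96 (96.2)] -/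
theorem sum_fderiv_coulomb (M : ℝ) {y : E3} (hy : y ≠ 0) :
    ∑ l : Fin 3, fderiv ℝ (fun z : E3 ↦ M / (4 * Real.pi) * (z l / ‖z‖ ^ 3)) y
      (EuclideanSpace.single l 1) = 0 := by
  have h : ∀ l : Fin 3, fderiv ℝ (fun z : E3 ↦ M / (4 * Real.pi) * (z l / ‖z‖ ^ 3)) y
      (EuclideanSpace.single l 1) =
      M / (4 * Real.pi) * fderiv ℝ (fun z : E3 ↦ z l / ‖z‖ ^ 3) y (EuclideanSpace.single l 1) := by
    intro l
    rw [((hasFDerivAt_coord_div_norm_pow hy l 3).const_mul (M / (4 * Real.pi))).fderiv,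
      (hasFDerivAt_coord_div_norm_pow hy l 3).fderiv]
    simp only [FunLike.coe_smul, Pi.smul_apply, smul_eq_mul]
  simp_rw [h]
  rw [← Finset.mul_sum, sum_fderiv_coord_div_norm_pow hy 3]
  norm_num

/-- **`Σ_l ∂_l [−M x_j x_l / (4π r⁴)] = 0`** off the origin: the Schwarzschild momentum-flux
densities `h^{j0·}` are divergence free. [cite: LandauLifshitz1975, §96 (96.2)] -/
theorem sum_fderiv_dipoleQuartic (M : ℝ) {y : E3} (hy : y ≠ 0) (j : Fin 3) :
    ∑ l : Fin 3, fderiv ℝ (fun z : E3 ↦ -(M / (4 * Real.pi)) * (z l * z j / ‖z‖ ^ 4)) y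
      (EuclideanSpace.single l 1) = 0 := by
  have h : ∀ l : Fin 3, fderiv ℝ (fun z : E3 ↦ -(M / (4 * Real.pi)) * (z l * z j / ‖z‖ ^ 4)) y
      (EuclideanSpace.single l 1) = -(M / (4 * Real.pi)) *
        fderiv ℝ (fun z : E3 ↦ z l * z j / ‖z‖ ^ 4) y (EuclideanSpace.single l 1) := by
    intro l
    rw [((hasFDerivAt_coord_mul_coord_div_norm_pow hy l j 4).const_mul _).fderiv,
      (hasFDerivAt_coord_mul_coord_div_norm_pow hy l j 4).fderiv]
    simp only [FunLike.coe_smul, Pi.smul_apply, smul_eq_mul]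
  simp_rw [h]
  rw [← Finset.mul_sum, sum_fderiv_coord_mul_coord_div_norm_pow hy j 4]
  norm_num


/-! ### Differentiability of the four potentials off the origin -/

/-- The momentum potential `−δ_{lj}(1 + 2M/r) + 2M x_l x_j / r³` is differentiable off the origin.
[folklore] -/
theorem differentiableAt_momentumPotential (M : ℝ) {y : E3} (hy : y ≠ 0) (l j : Fin 3) :
    DifferentiableAt ℝ (fun z : E3 ↦ -(if l = j then (1 : ℝ) else 0) * (1 + 2 * M / ‖z‖) +
      2 * M * (z l * z j / ‖z‖ ^ 3)) y := by
  have h1 : HasFDerivAt (fun z : E3 ↦ 1 + 2 * M / ‖z‖)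
      ((-(2 * M * (1 : ℕ)) / ‖y‖ ^ (1 + 2)) • E3.covec y) y := by
    have h := (hasFDerivAt_const_div_norm_pow (2 * M) hy 1).const_add 1
    simp_rw [pow_one] at h
    exact h
  exact ((h1.const_mul _).fun_add
    ((hasFDerivAt_coord_mul_coord_div_norm_pow hy l j 3).const_mul (2 * M))).differentiableAt

/-- The flux potential `2M (x_k δ_{lj} − x_l δ_{kj}) / r²` is differentiable off the origin.
[folklore] -/
theorem differentiableAt_fluxPotential (M : ℝ) {y : E3} (hy : y ≠ 0) (k l j : Fin 3) :
    DifferentiableAt ℝ (fun z : E3 ↦ 2 * M * ((if l = j then (1 : ℝ) else 0) * (z k / ‖z‖ ^ 2) -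
      (if k = j then (1 : ℝ) else 0) * (z l / ‖z‖ ^ 2))) y :=
  ((((hasFDerivAt_coord_div_norm_pow hy k 2).const_mul _).fun_sub
    ((hasFDerivAt_coord_div_norm_pow hy l 2).const_mul _)).const_mul (2 * M)).differentiableAt

/-- The Coulomb density `M x_l / (4π r³)` is differentiable off the origin. [folklore] -/
theorem differentiableAt_coulomb (M : ℝ) {y : E3} (hy : y ≠ 0) (l : Fin 3) :
    DifferentiableAt ℝ (fun z : E3 ↦ M / (4 * Real.pi) * (z l / ‖z‖ ^ 3)) y :=
  ((hasFDerivAt_coord_div_norm_pow hy l 3).const_mul _).differentiableAt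

/-- The dipole-quartic density `−M x_l x_j / (4π r⁴)` is differentiable off the origin.
[folklore] -/
theorem differentiableAt_dipoleQuartic (M : ℝ) {y : E3} (hy : y ≠ 0) (l j : Fin 3) :
    DifferentiableAt ℝ (fun z : E3 ↦ -(M / (4 * Real.pi)) * (z l * z j / ‖z‖ ^ 4)) y :=
  ((hasFDerivAt_coord_mul_coord_div_norm_pow hy l j 4).const_mul _).differentiableAt

/-! ### Functions of the spatial part on `E4` -/

/-- **A function constant along a line has vanishing derivative along it** — whether or not it
is differentiable there (then `fderiv = 0` by convention). [folklore] -/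
theorem fderiv_apply_eq_zero_of_forall_add_smul {F : E4 → ℝ} {x v : E4}
    (h : ∀ s : ℝ, F (x + s • v) = F x) : fderiv ℝ F x v = 0 := by
  by_cases hF : DifferentiableAt ℝ F x
  · have hline : HasDerivAt (fun s : ℝ ↦ F (x + s • v)) (fderiv ℝ F x v) 0 := by
      have hpath : HasDerivAt (fun s : ℝ ↦ x + s • v) v 0 := by
        simpa using ((hasDerivAt_id (0 : ℝ)).smul_const v).const_add x
      have hF' : HasFDerivAt F (fderiv ℝ F x) (x + (0 : ℝ) • v) := by
        rw [zero_smul, add_zero]; exact hF.hasFDerivAt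
      exact hF'.comp_hasDerivAt 0 hpath
    have hconst : HasDerivAt (fun s : ℝ ↦ F (x + s • v)) 0 0 := by
      simp_rw [h]; exact hasDerivAt_const 0 (F x)
    exact hline.unique hconst
  · rw [fderiv_zero_of_not_differentiableAt hF]; rfl

/-- **Coordinate partials on `E4` of a function of the spatial part**:
`∂_β [y ↦ φ(ȳ)](x) = Dφ(x̄)(spatial ∂_β)` for `φ` differentiable at `x̄`. [folklore] -/
theorem partialDeriv_comp_spatial {φ : E3 → ℝ} {x : E4} (hφ : DifferentiableAt ℝ φ (E4.spatial x))
    (β : Fin 4) :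
    partialDeriv β (fun y ↦ φ (E4.spatial y)) x =
      fderiv ℝ φ (E4.spatial x) (E4.spatial (E4.basisVector β)) := by
  rw [partialDeriv, show (fun y ↦ φ (E4.spatial y)) = φ ∘ E4.spatial from rfl,
    fderiv_comp x hφ E4.spatial.differentiableAt, E4.spatial.fderiv, ContinuousLinearMap.comp_apply]


/-- **The Coulomb field `x̄ / r³` is divergence free off the origin**, registered form (sub-goal
`coulomb_divergence_free` of the crux item). [folklore] -/
theorem coulomb_divergence_free : ∀ (y : EuclideanSpace ℝ (Fin 3)), y ≠ 0 → ∑ l : Fin 3, fderiv ℝ (fun z : EuclideanSpace ℝ (Fin 3) ↦ z l / ‖z‖ ^ 3) y (EuclideanSpace.single l 1) = 0 := by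
  intro y hy
  have h := sum_fderiv_coord_div_norm_pow hy 3
  norm_num at h
  exact h

end LLSchwarzschild

end Summit.FinalStateConjecture.FinalStateConjecture.Theorems

end
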